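import Summits.QuantumFields.YangMills.Theorems.BalabanUVNodesN15KingModelPauliLinks
import HarnessLib

/-!
# BalabanUVNodes ∕ N15 — THE KING-MODEL RUNG (PART Ϸ-d): THE GAP OF THE PAULI PAIR — `Re⟨v,(−cΔ_W+m²)v⟩ ≥ (m² + c·min(sin²a, sin²b))·Σ_x‖v_x‖²` on EVERY torus for the constant
# non-abelian link field `W_{ν₀} = e^{iaσ₁}`, `W_{ν₁} = e^{ibσ₂}`: a sum-of-squares fibre lemma + the Bloch constraint + PART Ϸ-a's symbol; the bound is LINEAR in the curvature
# `2|sin a sin b|` at fixed anisotropy and beats PART Ϳ's plaquette road (`≤ 2c·sin²a·sin²b`) by the factor `1∕(2·max(sin²a, sin²b))`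
# (Track A, DAG node N15 = NE2; FAN-OUT v1.1 §N15 s3 «KING-MODEL RUNG … + what the curved case adds»; count-neutral)

HONEST FRAMING.  Count-neutral (cell `pub-ymgap`, seat `pub-ymgap-dag-n15-e` g48; `--supports stmt-QuantumFields-27247 --as helper` = K3ᴬ, KEY MAP v3).  King's fine covariance layer
`−cΔ_U + m²` (Ͱ-a `covLapF`; [Balaban1985BackgroundPropagators] (3.23) p.394, [King1986] (4.4) p.670) at ONE constant `SU(2)` link pair on one finite torus per spacing; elementary real
algebra in each momentum fibre; constants volume-independent; NOT Bałaban's `G_k(U)` (no block term), NOT [Balaban1985BackgroundPropagators] (3.42); NOT a node discharge (N15 of record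
untouched); nothing continuum ∕ ℝ⁴ ∕ OS ∕ Clay.

THE IDEA (worked out before typing).  In the `q`-fibre (PART Ϸ-a∕b) the covariant kinetic energy of the pair is, with `ψ_μ = e^{iq′_μ} = x_μ + iy_μ`, `N = ‖ξ‖²`, `r₁ = ⟨σ₁⟩_ξ`, `r₂ = ⟨σ₂⟩_ξ`
(PART Ϸ-c `norm_sq_sub_smul_rotX∕Y`): `Σ_{μ∈{ν₀,ν₁}} [2(1 − x_μcos a_μ)N + 2y_μ sin a_μ·r_μ]`.  For ONE dressed direction the SUM OF SQUARES
`2(1 − xα)N² + 2yβ·rN − β²(N² − r²) = (Nα − Nx)² + (Ny + rβ)²` (`x²+y² = α²+β² = 1`) gives `2(1−xα)N + 2yβr ≥ β²(N − r²∕N)`; summing the two directions and using the BLOCH CONSTRAINT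
`r₁² + r₂² ≤ N²` (Ϸ-c `bloch_sq_le`) gives `≥ min(β₀², β₁²)·N` — UNIFORMLY IN THE MOMENTUM, hence on every torus (Ϸ-a `coercive_covLapF_kingConstLink_of_fibre`).  Over the Brillouin zone the
bound is asymptotically sharp (PART Ϸ-e: an exact eigenvalue `m² + 2c(1 − cos b)` at `q = (a, 0, …)`).

THE RESULTS (`K` any period vector; `c ≥ 0`; `a, b ∈ ℝ`; `ν₀ ≠ ν₁`; `W = pauliLink a b ν₀ ν₁`):
* §1 ★ `dressed_direction_sos` (the identity above), ★ `dressed_direction_ge`, ★★★ **`pauli_fibre_bound`** (`min(β₀²,β₁²)·N ≤ Σ_μ[2(1−x_μα_μ)N + 2y_μβ_μr_μ]` under `r₀²+r₁² ≤ N²`);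
* §2 ★★ **`pauli_fibre_coercive`** (`(m² + c·min(sin²a,sin²b))‖ξ‖² ≤ m²‖ξ‖² + cΣ_μ‖ξ − ψ_μ(q)W_μξ‖²` for EVERY momentum `q` and `ξ ∈ ℂ²`);
* §3 ★★★ **`re_quadForm_covLapF_pauliLink_ge`** (`(m² + c·min(sin²a, sin²b))·Σ_x‖v_x‖² ≤ Re⟨v,(−cΔ_W+m²)v⟩` on every torus), ★★ `eigenvalues_covLapF_pauliLink_ge`, ★★ **`posDef_covLapF_pauliLink_massless`**
  (`sin a·sin b ≠ 0`, `c > 0` ⟹ the MASSLESS `−cΔ_W ≻ 0`: non-commuting constant links generate a mass), ★★ `l2_opNorm_covLapF_pauliLink_massless_inv_le` (`‖(−cΔ_W)⁻¹‖ ≤ (c·min(sin²a,sin²b))⁻¹`,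
  volume-independent);
* §4 THE TWO ROADS COMPARED: ★ `plaqGap_one_sub_two_mul_le` (`λ(1 − 2t) ≤ t`, `0 ≤ t ≤ 1`), ★★ **`pauli_plaq_road_le`** (PART Ϳ's constant `2c·λ(1 − 2sin²a sin²b) ≤ 2c·sin²a·sin²b`), ★★
  **`pauli_fibre_road_vs_plaq_road`** (`2c·sin²a sin²b ≤ 2max(sin²a,sin²b) · c·min(sin²a,sin²b)`: the fibre constant dominates the plaquette constant by the factor `1∕(2max sin²)`, i.e.
  for all links with `|sin a|,|sin b| ≤ 1∕√2`, and by `≍ 1∕(2a²) → ∞` for small angles — LINEAR versus QUADRATIC in the curvature `2|sin a sin b|` at fixed anisotropy `|sin b|∕|sin a|`).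
WHAT THE NON-ABELIAN CURVED CASE ADDS (as theorems; cf. PART Ͱ-d∕Ϳ∕Ϡ): at `W ≡ 1` the massless operator has the constants in its kernel; at the Pauli pair with `sin a sin b ≠ 0` it is
invertible with `‖(−cΔ_W)⁻¹‖ ≤ (c·min(sin²a,sin²b))⁻¹` on EVERY torus; the mass is `≥ ½·(curvature)·(anisotropy ratio)` — half the abelian Landau rate of PART Ϡ in the isotropic case.
PRIOR TREE ART (by name): Ϸ-a (`kingConstLink`, `coercive_covLapF_kingConstLink_of_fibre`, `eigenvalues∕posDef∕l2_opNorm_covLapF_kingConstLink_…_of_fibre`), Ϸ-c (`pauliLink`, `pauliLink_fst∕snd`,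
`pauliLink_mem_unitaryGroup`, `norm_sq_sub_smul_rotX∕Y`, `bloch_sq_le`, `re_quadForm_covLapF_pauliLink_ge_plaq`), Ϳ-a (`plaqGap`), `TorusSpectral.norm_chi_eq_one`, Mathlib (`Real.sqrt_le_sqrt`,
`Real.le_sqrt`).  Dedup (rg at filing): basename 0 files; needles `dressed_direction_sos|pauli_fibre_bound|pauli_fibre_coercive|_pauliLink_ge|pauli_plaq_road_le` 0 tree files.
Locators: [King1986] (2.12) p.653, (4.4) p.670, (4.35) p.674; [Balaban1985BackgroundPropagators] (3.3) p.391, (3.23) p.394, (3.39) p.397; [DodziukMathai2006] §1 Cor 1.3.  0 `sorry`, 0 `def`.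
-/

noncomputable section

open scoped BigOperators ComplexConjugate ComplexOrder InnerProductSpace
open Finset Matrix WithLp

namespace Summit.QuantumFields.YangMills.BalabanUVNodes.N15KingModelRung.ConstantCurvature

open Literature.MathematicalPhysics.QuantumFieldTheory.Balaban1983to89.B5Prop11Plancherel (Tor unitVec chi)
open Summit.QuantumFields.YangMills.BalabanUVNodes.N15KingModelRung.Covariant (covLapF fib fib_apply isHermitian_covLapF)
open Summit.QuantumFields.YangMills.BalabanUVNodes.N15KingModelRung.TorusSpectral (norm_chi_eq_one)
open Summit.QuantumFields.YangMills.BalabanUVNodes.N15KingModelRung.Curvature (plaqGap)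

/-! ## §1 The sum-of-squares fibre lemma -/

section SOS

/-- ★ **ONE DRESSED DIRECTION, AS A SUM OF SQUARES**: for `x² + y² = 1` (the phase) and `α² + β² = 1` (the link angle),
`2(1 − xα)N² + 2yβ·rN − β²(N² − r²) = (Nα − Nx)² + (Ny + rβ)²`. [folklore] -/
theorem dressed_direction_sos (x y α β N r : ℝ) (hxy : x ^ 2 + y ^ 2 = 1) (hαβ : α ^ 2 + β ^ 2 = 1) :
    2 * (1 - x * α) * N ^ 2 + 2 * y * β * r * N - β ^ 2 * (N ^ 2 - r ^ 2) = (N * α - N * x) ^ 2 + (N * y + r * β) ^ 2 := by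
  linear_combination (-(N ^ 2)) * hxy - N ^ 2 * hαβ

/-- ★ … hence `β²(N² − r²) ≤ (2(1 − xα)N + 2yβr)·N`. [folklore] -/
theorem dressed_direction_ge (x y α β N r : ℝ) (hxy : x ^ 2 + y ^ 2 = 1) (hαβ : α ^ 2 + β ^ 2 = 1) :
    β ^ 2 * (N ^ 2 - r ^ 2) ≤ (2 * (1 - x * α) * N + 2 * y * β * r) * N := by
  nlinarith [dressed_direction_sos x y α β N r hxy hαβ, sq_nonneg (N * α - N * x), sq_nonneg (N * y + r * β)]

/-- ★★★ **THE FIBRE LEMMA**: two dressed directions with phases `x_μ + iy_μ` on the unit circle, link angles `(α_μ, β_μ) = (cos a_μ, sin a_μ)`, `N ≥ 0` and Bloch components with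
`r₀² + r₁² ≤ N²`: `min(β₀², β₁²)·N ≤ Σ_μ [2(1 − x_μα_μ)N + 2y_μβ_μr_μ]` — uniformly in the phases. [folklore] -/
theorem pauli_fibre_bound {x₀ y₀ x₁ y₁ α₀ β₀ α₁ β₁ N r₀ r₁ : ℝ} (h0 : x₀ ^ 2 + y₀ ^ 2 = 1) (h1 : x₁ ^ 2 + y₁ ^ 2 = 1) (hα0 : α₀ ^ 2 + β₀ ^ 2 = 1) (hα1 : α₁ ^ 2 + β₁ ^ 2 = 1)
    (hN : 0 ≤ N) (hr : r₀ ^ 2 + r₁ ^ 2 ≤ N ^ 2) :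
    min (β₀ ^ 2) (β₁ ^ 2) * N ≤ (2 * (1 - x₀ * α₀) * N + 2 * y₀ * β₀ * r₀) + (2 * (1 - x₁ * α₁) * N + 2 * y₁ * β₁ * r₁) := by
  have e0 := dressed_direction_ge x₀ y₀ α₀ β₀ N r₀ h0 hα0
  have e1 := dressed_direction_ge x₁ y₁ α₁ β₁ N r₁ h1 hα1
  have hm0 : min (β₀ ^ 2) (β₁ ^ 2) ≤ β₀ ^ 2 := min_le_left _ _
  have hm1 : min (β₀ ^ 2) (β₁ ^ 2) ≤ β₁ ^ 2 := min_le_right _ _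
  have hmin0 : 0 ≤ min (β₀ ^ 2) (β₁ ^ 2) := le_min (sq_nonneg _) (sq_nonneg _)
  have hpos0 : 0 ≤ N ^ 2 - r₀ ^ 2 := by nlinarith [sq_nonneg r₁]
  have hpos1 : 0 ≤ N ^ 2 - r₁ ^ 2 := by nlinarith [sq_nonneg r₀]
  rcases eq_or_lt_of_le hN with hN0 | hNpos
  · -- `N = 0`: both Bloch components vanish and both sides are `0`
    have hr0 : r₀ = 0 := by nlinarith [sq_nonneg r₀, sq_nonneg r₁]
    have hr1 : r₁ = 0 := by nlinarith [sq_nonneg r₀, sq_nonneg r₁]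
    rw [← hN0, hr0, hr1]; simp
  · have key : min (β₀ ^ 2) (β₁ ^ 2) * N * N ≤ ((2 * (1 - x₀ * α₀) * N + 2 * y₀ * β₀ * r₀) + (2 * (1 - x₁ * α₁) * N + 2 * y₁ * β₁ * r₁)) * N := by
      nlinarith [mul_le_mul_of_nonneg_right hm0 hpos0, mul_le_mul_of_nonneg_right hm1 hpos1, mul_le_mul_of_nonneg_left hr hmin0]
    exact le_of_mul_le_mul_right key hNpos

end SOS

/-! ## §2 The fibre of the Pauli pair is coercive, uniformly in the momentum -/

section Fibre

variable {d : ℕ} (K : Fin (d + 1) → ℕ) [hK : ∀ μ, NeZero (K μ)]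

/-- `|ψ|² = (Re ψ)² + (Im ψ)² = 1` for the phases `ψ_μ(q) = χ_q(e_μ)`. [cite: King1986, (4.35) p.674] -/
theorem re_sq_add_im_sq_chi_unitVec (q : Tor K) (μ : Fin (d + 1)) : (chi K q (unitVec K μ)).re ^ 2 + (chi K q (unitVec K μ)).im ^ 2 = 1 := by
  have h := norm_chi_eq_one K q (unitVec K μ)
  have h2 : ‖chi K q (unitVec K μ)‖ ^ 2 = 1 := by rw [h, one_pow]
  rw [Complex.sq_norm, Complex.normSq_apply] at h2
  nlinarith [h2]

/-- ★★ **THE PAULI FIBRE IS COERCIVE, UNIFORMLY IN THE MOMENTUM**: for every `q ∈ T̂` and `ξ ∈ ℂ²`,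
`(m² + c·min(sin²a, sin²b))·‖ξ‖² ≤ m²‖ξ‖² + c·Σ_μ‖ξ − ψ_μ(q)·W_μξ‖²` (`c ≥ 0`, `ν₀ ≠ ν₁`; only the two dressed directions are used, the flat ones are dropped).
[cite: King1986, (4.4) p.670, (4.35) p.674; Balaban1985BackgroundPropagators, (3.3) p.391, (3.23) p.394] -/
theorem pauli_fibre_coercive {c : ℝ} (hc : 0 ≤ c) (m2 a b : ℝ) {ν₀ ν₁ : Fin (d + 1)} (hν : ν₀ ≠ ν₁) (q : Tor K) (ξ : EuclideanSpace ℂ (Fin 2)) :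
    (m2 + c * min (Real.sin a ^ 2) (Real.sin b ^ 2)) * ‖ξ‖ ^ 2
      ≤ m2 * ‖ξ‖ ^ 2 + c * ∑ μ, ‖ξ - chi K q (unitVec K μ) • Matrix.toEuclideanLin (pauliLink (d := d) a b ν₀ ν₁ μ) ξ‖ ^ 2 := by
  -- keep the two dressed directions
  have hdrop : ‖ξ - chi K q (unitVec K ν₀) • Matrix.toEuclideanLin (pauliLink (d := d) a b ν₀ ν₁ ν₀) ξ‖ ^ 2
      + ‖ξ - chi K q (unitVec K ν₁) • Matrix.toEuclideanLin (pauliLink (d := d) a b ν₀ ν₁ ν₁) ξ‖ ^ 2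
      ≤ ∑ μ, ‖ξ - chi K q (unitVec K μ) • Matrix.toEuclideanLin (pauliLink (d := d) a b ν₀ ν₁ μ) ξ‖ ^ 2 := by
    have hpair : ∑ μ ∈ ({ν₀, ν₁} : Finset (Fin (d + 1))), ‖ξ - chi K q (unitVec K μ) • Matrix.toEuclideanLin (pauliLink (d := d) a b ν₀ ν₁ μ) ξ‖ ^ 2
        = ‖ξ - chi K q (unitVec K ν₀) • Matrix.toEuclideanLin (pauliLink (d := d) a b ν₀ ν₁ ν₀) ξ‖ ^ 2
          + ‖ξ - chi K q (unitVec K ν₁) • Matrix.toEuclideanLin (pauliLink (d := d) a b ν₀ ν₁ ν₁) ξ‖ ^ 2 := Finset.sum_pair hν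
    rw [← hpair]
    exact Finset.sum_le_sum_of_subset_of_nonneg (Finset.subset_univ _) fun _ _ _ => sq_nonneg _
  rw [pauliLink_fst, pauliLink_snd a b hν, norm_sq_sub_smul_rotX a (norm_chi_eq_one K q (unitVec K ν₀)) ξ,
    norm_sq_sub_smul_rotY b (norm_chi_eq_one K q (unitVec K ν₁)) ξ] at hdrop
  have hfib := pauli_fibre_bound (re_sq_add_im_sq_chi_unitVec K q ν₀) (re_sq_add_im_sq_chi_unitVec K q ν₁) (Real.cos_sq_add_sin_sq a) (Real.cos_sq_add_sin_sq b)
    (sq_nonneg ‖ξ‖) (bloch_sq_le ξ)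
  have hmin : min (Real.sin a ^ 2) (Real.sin b ^ 2) * ‖ξ‖ ^ 2
      ≤ ∑ μ, ‖ξ - chi K q (unitVec K μ) • Matrix.toEuclideanLin (pauliLink (d := d) a b ν₀ ν₁ μ) ξ‖ ^ 2 := by
    refine le_trans ?_ hdrop
    nlinarith [hfib]
  nlinarith [mul_le_mul_of_nonneg_left hmin hc]

end Fibre

/-! ## §3 The gap on the torus -/

section Torus

variable {d : ℕ} (K : Fin (d + 1) → ℕ) [hK : ∀ μ, NeZero (K μ)]

/-- ★★★ **THE GAP OF THE PAULI PAIR**: on EVERY torus, for `c ≥ 0`, every `m²`, every `a, b` and `ν₀ ≠ ν₁`,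
`(m² + c·min(sin²a, sin²b))·Σ_x‖v_x‖² ≤ Re⟨v, (−cΔ_W+m²)v⟩`, `W_{ν₀} = e^{iaσ₁}`, `W_{ν₁} = e^{ibσ₂}` — a mass generated by CONSTANT NON-COMMUTING links, linear in the curvature
`2|sin a sin b|` at fixed anisotropy (`= |sin a sin b|·min∕max`), volume-independent. [cite: King1986, (4.4) p.670, (4.35) p.674; Balaban1985BackgroundPropagators, (3.23) p.394; DodziukMathai2006, Cor 1.3 §1] -/
theorem re_quadForm_covLapF_pauliLink_ge {c : ℝ} (hc : 0 ≤ c) (m2 a b : ℝ) {ν₀ ν₁ : Fin (d + 1)} (hν : ν₀ ≠ ν₁) (v : Tor K × Fin 2 → ℂ) :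
    (m2 + c * min (Real.sin a ^ 2) (Real.sin b ^ 2)) * ∑ x, ‖fib K v x‖ ^ 2
      ≤ RCLike.re (star v ⬝ᵥ (covLapF K c m2 (kingConstLink K (pauliLink a b ν₀ ν₁)) *ᵥ v)) :=
  coercive_covLapF_kingConstLink_of_fibre K (pauliLink_mem_unitaryGroup a b ν₀ ν₁) c m2 (fun q ξ => pauli_fibre_coercive K hc m2 a b hν q ξ) v

/-- ★★ EVERY EIGENVALUE of `−cΔ_W + m²` is `≥ m² + c·min(sin²a, sin²b)`. [cite: King1986, (4.4) p.670; Balaban1985BackgroundPropagators, (3.23) p.394] -/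
theorem eigenvalues_covLapF_pauliLink_ge {c : ℝ} (hc : 0 ≤ c) (m2 a b : ℝ) {ν₀ ν₁ : Fin (d + 1)} (hν : ν₀ ≠ ν₁) (i : Tor K × Fin 2) :
    m2 + c * min (Real.sin a ^ 2) (Real.sin b ^ 2) ≤ (isHermitian_covLapF K c m2 (kingConstLink K (pauliLink a b ν₀ ν₁))).eigenvalues i :=
  eigenvalues_covLapF_kingConstLink_ge_of_fibre K (pauliLink_mem_unitaryGroup a b ν₀ ν₁) c m2 (fun q ξ => pauli_fibre_coercive K hc m2 a b hν q ξ) i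

/-- `min(sin²a, sin²b) > 0` iff both links are genuinely dressed (`sin a ≠ 0`, `sin b ≠ 0`), i.e. iff `[W_{ν₀},W_{ν₁}] ≠ 0` (Ϸ-c `rotX_mul_rotY_sub`). [folklore] -/
theorem min_sin_sq_pos {a b : ℝ} (ha : Real.sin a ≠ 0) (hb : Real.sin b ≠ 0) : 0 < min (Real.sin a ^ 2) (Real.sin b ^ 2) :=
  lt_min (by positivity) (by positivity)

/-- ★★ **NON-COMMUTING CONSTANT LINKS GENERATE A MASS**: for `c > 0` and `sin a·sin b ≠ 0` the MASSLESS covariant Laplacian `−cΔ_W` of the Pauli pair is POSITIVE DEFINITE on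
every torus (at `W ≡ 1` it has the constants in its kernel, PART Ͱ-d `not_posDef_covLapF_massless_free`). [cite: DodziukMathai2006, Cor 1.3 §1; Balaban1985BackgroundPropagators, (3.23) p.394] -/
theorem posDef_covLapF_pauliLink_massless {c : ℝ} (hc : 0 < c) {a b : ℝ} (ha : Real.sin a ≠ 0) (hb : Real.sin b ≠ 0) {ν₀ ν₁ : Fin (d + 1)} (hν : ν₀ ≠ ν₁) :
    (covLapF K c 0 (kingConstLink K (pauliLink a b ν₀ ν₁))).PosDef := by
  have hκ : 0 < (0 : ℝ) + c * min (Real.sin a ^ 2) (Real.sin b ^ 2) := by rw [zero_add]; exact mul_pos hc (min_sin_sq_pos ha hb)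
  exact posDef_covLapF_kingConstLink_of_fibre K (pauliLink_mem_unitaryGroup a b ν₀ ν₁) c 0 hκ (fun q ξ => pauli_fibre_coercive K hc.le 0 a b hν q ξ)

/-- ★★ **POSITIVE DEFINITE WITH A MASS FLOOR**: `m² + c·min(sin²a,sin²b) > 0` ⟹ `−cΔ_W + m² ≻ 0` (negative `m²` down to `−c·min(sin²a,sin²b)` allowed). [cite: Balaban1985BackgroundPropagators, (3.23) p.394] -/
theorem posDef_covLapF_pauliLink {c : ℝ} (hc : 0 ≤ c) {m2 a b : ℝ} (hκ : 0 < m2 + c * min (Real.sin a ^ 2) (Real.sin b ^ 2)) {ν₀ ν₁ : Fin (d + 1)} (hν : ν₀ ≠ ν₁) :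
    (covLapF K c m2 (kingConstLink K (pauliLink a b ν₀ ν₁))).PosDef :=
  posDef_covLapF_kingConstLink_of_fibre K (pauliLink_mem_unitaryGroup a b ν₀ ν₁) c m2 hκ (fun q ξ => pauli_fibre_coercive K hc m2 a b hν q ξ)

open scoped Matrix.Norms.L2Operator in
/-- ★★ **THE COVARIANCE IS BOUNDED BY THE INVERSE MASS FLOOR**: `‖(−cΔ_W+m²)⁻¹‖_{ℓ²→ℓ²} ≤ (m² + c·min(sin²a,sin²b))⁻¹`, on every torus.
[cite: Balaban1985BackgroundPropagators, (3.39) p.397; King1986, (4.4) p.670] -/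
theorem l2_opNorm_covLapF_pauliLink_inv_le {c : ℝ} (hc : 0 ≤ c) {m2 a b : ℝ} (hκ : 0 < m2 + c * min (Real.sin a ^ 2) (Real.sin b ^ 2)) {ν₀ ν₁ : Fin (d + 1)} (hν : ν₀ ≠ ν₁) :
    ‖(covLapF K c m2 (kingConstLink K (pauliLink a b ν₀ ν₁)))⁻¹‖ ≤ (m2 + c * min (Real.sin a ^ 2) (Real.sin b ^ 2))⁻¹ :=
  l2_opNorm_covLapF_kingConstLink_inv_le_of_fibre K (pauliLink_mem_unitaryGroup a b ν₀ ν₁) c m2 hκ (fun q ξ => pauli_fibre_coercive K hc m2 a b hν q ξ)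

open scoped Matrix.Norms.L2Operator in
/-- ★★ **THE MASSLESS COVARIANCE OF THE PAULI PAIR**: `‖(−cΔ_W)⁻¹‖_{ℓ²→ℓ²} ≤ (c·min(sin²a, sin²b))⁻¹` (`c > 0`, `sin a sin b ≠ 0`), uniformly in the volume — the curvature plays the
part of the mass. [cite: Balaban1985BackgroundPropagators, (3.39) p.397; DodziukMathai2006, Cor 1.3 §1] -/
theorem l2_opNorm_covLapF_pauliLink_massless_inv_le {c : ℝ} (hc : 0 < c) {a b : ℝ} (ha : Real.sin a ≠ 0) (hb : Real.sin b ≠ 0) {ν₀ ν₁ : Fin (d + 1)} (hν : ν₀ ≠ ν₁) :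
    ‖(covLapF K c 0 (kingConstLink K (pauliLink a b ν₀ ν₁)))⁻¹‖ ≤ (c * min (Real.sin a ^ 2) (Real.sin b ^ 2))⁻¹ := by
  have hκ : 0 < (0 : ℝ) + c * min (Real.sin a ^ 2) (Real.sin b ^ 2) := by rw [zero_add]; exact mul_pos hc (min_sin_sq_pos ha hb)
  have h := l2_opNorm_covLapF_pauliLink_inv_le K hc.le hκ hν
  rwa [zero_add] at h

end Torus

/-! ## §4 The fibre road versus the plaquette road -/

section Comparison

/-- ★ `λ(1 − 2t) ≤ t` for `0 ≤ t ≤ 1` (`λ = plaqGap`; `λ(1−2t) = 2 − √(2 + 2√(1−t))`, and `√(1−t) ≥ 1 − t`, `√(4 − 2t) ≥ 2 − t`). [cite: DodziukMathai2006, Cor 1.3 §1] -/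
theorem plaqGap_one_sub_two_mul_le {t : ℝ} (h0 : 0 ≤ t) (h1 : t ≤ 1) : plaqGap (1 - 2 * t) ≤ t := by
  unfold plaqGap
  have hA : 2 * (1 - t) ≤ Real.sqrt (2 + 2 * (1 - 2 * t)) := by
    have : 2 + 2 * (1 - 2 * t) = 4 * (1 - t) := by ring
    rw [this, Real.le_sqrt (by linarith) (by linarith)]
    nlinarith
  have hB : 2 - t ≤ Real.sqrt (2 + Real.sqrt (2 + 2 * (1 - 2 * t))) := by
    rw [Real.le_sqrt (by linarith) (by positivity)]
    nlinarith [hA]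
  linarith

/-- ★★ **THE PLAQUETTE ROAD's CONSTANT IS QUADRATIC**: PART Ϳ's mass for the Pauli pair is at most `2c·sin²a·sin²b` (`c ≥ 0`). [cite: DodziukMathai2006, Cor 1.3 §1; King1986, (2.12) p.653] -/
theorem pauli_plaq_road_le {c : ℝ} (hc : 0 ≤ c) (a b : ℝ) :
    2 * c * plaqGap (1 - 2 * (Real.sin a) ^ 2 * (Real.sin b) ^ 2) ≤ 2 * c * ((Real.sin a) ^ 2 * (Real.sin b) ^ 2) := by
  have ht0 : 0 ≤ (Real.sin a) ^ 2 * (Real.sin b) ^ 2 := by positivity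
  have ht1 : (Real.sin a) ^ 2 * (Real.sin b) ^ 2 ≤ 1 := by
    have := Real.sin_sq_le_one a; have := Real.sin_sq_le_one b
    nlinarith [sq_nonneg (Real.sin a), sq_nonneg (Real.sin b)]
  have h := plaqGap_one_sub_two_mul_le ht0 ht1
  rw [show 2 * (Real.sin a) ^ 2 * (Real.sin b) ^ 2 = 2 * ((Real.sin a) ^ 2 * (Real.sin b) ^ 2) by ring]
  exact mul_le_mul_of_nonneg_left h (by positivity)

/-- ★★ **THE FIBRE ROAD DOMINATES THE PLAQUETTE ROAD BY THE FACTOR `1∕(2·max(sin²a, sin²b))`**: `2c·sin²a·sin²b ≤ 2·max(sin²a,sin²b)·(c·min(sin²a,sin²b))`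
(`min·max = sin²a·sin²b`): for links with `|sin a|, |sin b| ≤ 1∕√2` the fibre constant is the larger, and for small angles by `≍ 1∕(2a²) → ∞` — linear versus quadratic in the curvature.
[cite: DodziukMathai2006, Cor 1.3 §1; King1986, (2.12) p.653] -/
theorem pauli_fibre_road_vs_plaq_road {c : ℝ} (hc : 0 ≤ c) (a b : ℝ) :
    2 * c * plaqGap (1 - 2 * (Real.sin a) ^ 2 * (Real.sin b) ^ 2)
      ≤ 2 * max (Real.sin a ^ 2) (Real.sin b ^ 2) * (c * min (Real.sin a ^ 2) (Real.sin b ^ 2)) := by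
  have h := pauli_plaq_road_le hc a b
  have hmm : min (Real.sin a ^ 2) (Real.sin b ^ 2) * max (Real.sin a ^ 2) (Real.sin b ^ 2) = Real.sin a ^ 2 * Real.sin b ^ 2 := min_mul_max _ _
  nlinarith [hmm]

/-- ★ IN THE SMALL-LINK REGIME THE FIBRE ROAD WINS: if `max(sin²a, sin²b) ≤ 1∕2` then PART Ϳ's constant `2c·λ(1 − 2sin²a sin²b) ≤ c·min(sin²a, sin²b)` (PART Ϸ-d's).
[cite: DodziukMathai2006, Cor 1.3 §1; King1986, (2.12) p.653] -/
theorem pauli_plaq_road_le_fibre_road {c : ℝ} (hc : 0 ≤ c) {a b : ℝ} (hsmall : max (Real.sin a ^ 2) (Real.sin b ^ 2) ≤ 1 / 2) :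
    2 * c * plaqGap (1 - 2 * (Real.sin a) ^ 2 * (Real.sin b) ^ 2) ≤ c * min (Real.sin a ^ 2) (Real.sin b ^ 2) := by
  have h := pauli_fibre_road_vs_plaq_road hc a b
  have hmin0 : 0 ≤ c * min (Real.sin a ^ 2) (Real.sin b ^ 2) := mul_nonneg hc (le_min (sq_nonneg _) (sq_nonneg _))
  nlinarith [mul_le_mul_of_nonneg_right hsmall hmin0]

end Comparison

end Summit.QuantumFields.YangMills.BalabanUVNodes.N15KingModelRung.ConstantCurvature

end
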